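import Summits.KontsevichZagierPeriods.Zeta5Search.Denom.DigitCert
import Literature.NumberTheory.Irrationality.Zudilin2014.FirstTaleLemma7
import Literature.NumberTheory.Irrationality.Zudilin2014.SecondTalePadic
import HarnessLib

/-!
# Two-tale points — the DIGIT BRIDGE: Zudilin's Lemma-7 / Lemma-8 digit counts ARE floor tables of the parametric
cell checker `Denom.DigitCert` (cell `pub-zeta5`, fam-denom 60; generic in the cone point, serves every rung)

HONEST FRAMING: systematic search; no irrationality claim unless certified.

OUR theorem (Summit side), `p`-adic bookkeeping only.  Along any two-tale cone point with level-`n` parameters of the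
printed shape [Zudilin2014ZetaTwo, Section 3 and Section 6]

* first tale `a = (α_i n + 1)_i`, `b = (β₀n+1, β₁n+1, β₂n+1, β₃n+2)` (`aOne α n`, `bOne β n`),
* second tale (the partner) `â = (A₀n+2; A₁n+1, A₂n+1, A₃n+1)`, `b̂ = (B₀n+2; B₁n+1, B₂n+2, B₃n+2)` (`aTwo A n`, `bTwo B n`),

the two digit counts of the Literature layer are EXACTLY term lists of `Denom.DigitCert` evaluated at `x = n/p`:

* (L7) `ord_p Π(a,b) − ord_p Π(σa,b) = Σ_{T ∈ terms7 α β σ} T(n/p, 0)` (`padicValRat_Pi_sub_eq_evalTerms`; the four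
  Legendre digits of `Zudilin2014.padicValRat_Pi_eq`, all `y`-free), and
* (L8) `digitT p â b̂ k = Σ_{T ∈ terms8 A B} T(n/p, (k−1)/p)` (`digitT_eq_evalTerms`; the twelve floors of
  `Zudilin2014.digitT_eq`, i.e. the printed right-hand side of (T3a)),

both doubly periodic (`terms7_sum_cx`, `terms8_sum_cy`, `terms8_sum_cx`).  Hence a CERTIFIED CELL of the checker —
`Cell.check (terms7 α β σ) C = true`, resp. `Cell.check (terms8 A B) C = true` — bounds the digit count from below by
`C.c` for EVERY prime whose shifted ratio `n/p − m` lies in the cell (`piDiff_ge_of_checked_cell`,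
`digitT_ge_of_checked_cell`), and the Literature lemmas turn that into the consumer statements
`p^c ∣ q(a,b)`, `p^c ∣ D_{M₁}D_{M₂} p(a,b)` (Lemma 7: `pow_dvd_formQZ_of_cell`, `pow_dvd_formPZ_of_cell`) and
`‖q̂(â,b̂)‖_p ≤ p^{−c}`, `‖p̂(â,b̂)‖_p ≤ p^{2−c}` (Lemma 8: `padicNorm_formQT_le_of_cell`, `padicNorm_formPT_le_of_cell`).
So every per-interval "cell theorem" of a two-tale rung is ONE ROW of a `decide`d table; nothing here is specific to a
point, and nothing bears on irrationality.  0 sorry.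
-/

namespace Summit.KontsevichZagierPeriods.Zeta5Search

namespace Denom.DigitBridge

open Finset DigitCert
open Literature.NumberTheory.Irrationality.Zudilin2014

/-! ### Floor identities -/

/-- `⌊c_y·(t/p) + c_x·(n/p)⌋ = ⌊(c_y t + c_x n)/p⌋` (integer division). -/
theorem floor_lin (p n : ℕ) (cy cx t : ℤ) :
    ⌊(cy : ℚ) * ((t : ℚ) / p) + (cx : ℚ) * ((n : ℚ) / p)⌋ = (cy * t + cx * n) / (p : ℤ) := by
  rw [← Rat.floor_intCast_div_natCast]; congr 1; push_cast; ring

/-- `⌊c_y·0 + c_x·(n/p)⌋ = ⌊c_x n/p⌋` (integer division). -/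
theorem floor_lin_zero (p n : ℕ) (cy cx : ℤ) :
    ⌊(cy : ℚ) * (0 : ℚ) + (cx : ℚ) * ((n : ℚ) / p)⌋ = (cx * n) / (p : ℤ) := by
  rw [← Rat.floor_intCast_div_natCast]; congr 1; push_cast; ring

/-- A Legendre digit as an integer division: `⌊z/p⌋` computed in `ℕ` on `z.toNat` is `z / p` for `z ≥ 0`. -/
theorem legendre_cast {z : ℤ} (hz : 0 ≤ z) (p : ℕ) : (((z.toNat / p : ℕ)) : ℤ) = z / (p : ℤ) := by
  rw [Int.natCast_div, Int.toNat_of_nonneg hz]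

/-- `Σ T` over a concatenation. -/
theorem evalTerms_append (ts us : List Term) (x y : ℚ) :
    evalTerms (ts ++ us) x y = evalTerms ts x y + evalTerms us x y := by
  simp [evalTerms, List.map_append, List.sum_append]

/-- The term list with every coefficient negated. -/
def negTerms (ts : List Term) : List Term := ts.map fun T => ⟨-T.coef, T.cy, T.cx⟩

/-- `Σ (−T) = −Σ T`. -/
theorem evalTerms_negTerms (ts : List Term) (x y : ℚ) : evalTerms (negTerms ts) x y = -evalTerms ts x y := by
  induction ts with
  | nil => simp [evalTerms, negTerms]
  | cons T ts ih =>
    simp only [evalTerms, negTerms, List.map_cons, List.sum_cons, Term.eval] at ih ⊢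
    rw [ih]; ring

/-- `Σ coef·c_x` over the negated list. -/
theorem negTerms_sum_cx (ts : List Term) :
    ((negTerms ts).map fun T => T.coef * T.cx).sum = -(ts.map fun T => T.coef * T.cx).sum := by
  induction ts with
  | nil => simp [negTerms]
  | cons T ts ih => simp only [negTerms, List.map_cons, List.sum_cons] at ih ⊢; rw [ih]; ring

/-- `Σ coef·c_y` over the negated list. -/
theorem negTerms_sum_cy (ts : List Term) :
    ((negTerms ts).map fun T => T.coef * T.cy).sum = -(ts.map fun T => T.coef * T.cy).sum := by
  induction ts with
  | nil => simp [negTerms]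
  | cons T ts ih => simp only [negTerms, List.map_cons, List.sum_cons] at ih ⊢; rw [ih]; ring

/-- From the cross-multiplied cell membership to the checker's hypotheses on `x = (n − m p)/p = n/p − m`. -/
theorem cell_mem_div {C : Cell} (hb : 0 < C.b0 ∧ 0 < C.b1) {n p : ℕ} (hp : 0 < p) (m : ℕ)
    (hx0 : C.a0 * (p : ℤ) < (C.b0 : ℤ) * ((n : ℤ) - m * p)) (hx1 : (C.b1 : ℤ) * ((n : ℤ) - m * p) < C.a1 * (p : ℤ)) :
    (C.a0 : ℚ) / C.b0 < (n : ℚ) / p - m ∧ (n : ℚ) / p - m < (C.a1 : ℚ) / C.b1 := by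
  have hp' : (0 : ℚ) < p := by exact_mod_cast hp
  have hb0 : (0 : ℚ) < C.b0 := by exact_mod_cast hb.1
  have hb1 : (0 : ℚ) < C.b1 := by exact_mod_cast hb.2
  have hx : (n : ℚ) / p - m = ((((n : ℤ) - m * p : ℤ)) : ℚ) / (p : ℚ) := by
    push_cast; field_simp
  rw [hx, div_lt_div_iff₀ hb0 hp', div_lt_div_iff₀ hp' hb1]
  have h0 : C.a0 * (p : ℤ) < ((n : ℤ) - m * p) * (C.b0 : ℤ) := by linarith
  have h1 : ((n : ℤ) - m * p) * (C.b1 : ℤ) < C.a1 * (p : ℤ) := by linarith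
  exact ⟨by exact_mod_cast h0, by exact_mod_cast h1⟩

/-- The positivity conjunct of a passing check. -/
theorem denoms_pos_of_check {ts : List Term} {C : Cell} (h : Cell.check ts C = true) : 0 < C.b0 ∧ 0 < C.b1 := by
  simp only [Cell.check, Bool.and_eq_true, decide_eq_true_eq] at h; exact ⟨h.1.1.1, h.1.1.2⟩

/-! ### Second tale: the digit count of Lemma 8 as a floor table -/

/-- The partner's numerator parameters at level `n` from slopes: `â = (A₀n+2; A₁n+1, A₂n+1, A₃n+1)`. -/
def aTwo (A : Fin 4 → ℕ) (n : ℕ) : Fin 4 → ℤ := ![(A 0 : ℤ) * n + 2, (A 1 : ℤ) * n + 1, (A 2 : ℤ) * n + 1, (A 3 : ℤ) * n + 1]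

/-- The partner's denominator parameters at level `n` from slopes: `b̂ = (B₀n+2; B₁n+1, B₂n+2, B₃n+2)`. -/
def bTwo (B : Fin 4 → ℕ) (n : ℕ) : Fin 4 → ℤ := ![(B 0 : ℤ) * n + 2, (B 1 : ℤ) * n + 1, (B 2 : ℤ) * n + 2, (B 3 : ℤ) * n + 2]

/-- `â₀ = A₀n+2`. -/
@[simp] theorem aTwo_zero (A : Fin 4 → ℕ) (n : ℕ) : aTwo A n 0 = (A 0 : ℤ) * n + 2 := rfl
/-- `â₁ = A₁n+1`. -/
@[simp] theorem aTwo_one (A : Fin 4 → ℕ) (n : ℕ) : aTwo A n 1 = (A 1 : ℤ) * n + 1 := rfl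
/-- `â₂ = A₂n+1`. -/
@[simp] theorem aTwo_two (A : Fin 4 → ℕ) (n : ℕ) : aTwo A n 2 = (A 2 : ℤ) * n + 1 := rfl
/-- `â₃ = A₃n+1`. -/
@[simp] theorem aTwo_three (A : Fin 4 → ℕ) (n : ℕ) : aTwo A n 3 = (A 3 : ℤ) * n + 1 := rfl
/-- `b̂₀ = B₀n+2`. -/
@[simp] theorem bTwo_zero (B : Fin 4 → ℕ) (n : ℕ) : bTwo B n 0 = (B 0 : ℤ) * n + 2 := rfl
/-- `b̂₁ = B₁n+1`. -/
@[simp] theorem bTwo_one (B : Fin 4 → ℕ) (n : ℕ) : bTwo B n 1 = (B 1 : ℤ) * n + 1 := rfl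
/-- `b̂₂ = B₂n+2`. -/
@[simp] theorem bTwo_two (B : Fin 4 → ℕ) (n : ℕ) : bTwo B n 2 = (B 2 : ℤ) * n + 2 := rfl
/-- `b̂₃ = B₃n+2`. -/
@[simp] theorem bTwo_three (B : Fin 4 → ℕ) (n : ℕ) : bTwo B n 3 = (B 3 : ℤ) * n + 2 := rfl

/-- **The twelve floor terms of (T3a)** in the checker's format `coef·⌊c_y·y + c_x·x⌋`, `x = n/p`, `y = (k−1)/p`:
`⌊2y−B₀x⌋−⌊2y−A₀x⌋−⌊(A₀−B₀)x⌋ + ⌊y−B₁x⌋−⌊y−A₁x⌋−⌊(A₁−B₁)x⌋ + Σ_{j=2,3}(⌊(B_j−A_j)x⌋−⌊y−A_jx⌋−⌊B_jx−y⌋)`. -/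
def terms8 (A B : Fin 4 → ℕ) : List Term :=
  [⟨1, 2, -(B 0 : ℤ)⟩, ⟨-1, 2, -(A 0 : ℤ)⟩, ⟨-1, 0, (A 0 : ℤ) - B 0⟩,
   ⟨1, 1, -(B 1 : ℤ)⟩, ⟨-1, 1, -(A 1 : ℤ)⟩, ⟨-1, 0, (A 1 : ℤ) - B 1⟩,
   ⟨1, 0, (B 2 : ℤ) - A 2⟩, ⟨-1, 1, -(A 2 : ℤ)⟩, ⟨-1, -1, (B 2 : ℤ)⟩,
   ⟨1, 0, (B 3 : ℤ) - A 3⟩, ⟨-1, 1, -(A 3 : ℤ)⟩, ⟨-1, -1, (B 3 : ℤ)⟩]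

/-- **(L8) `digitT p â b̂ k = Σ_{T ∈ terms8 A B} T(n/p, (k−1)/p)`.** -/
theorem digitT_eq_evalTerms (A B : Fin 4 → ℕ) (n p : ℕ) (k : ℤ) :
    digitT p (aTwo A n) (bTwo B n) k = evalTerms (terms8 A B) ((n : ℚ) / p) ((((k - 1 : ℤ)) : ℚ) / p) := by
  rw [digitT_eq]
  simp only [evalTerms, terms8, List.map_cons, List.map_nil, List.sum_cons, List.sum_nil, Term.eval, floor_lin,
    aTwo_zero, aTwo_one, aTwo_two, aTwo_three, bTwo_zero, bTwo_one, bTwo_two, bTwo_three]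
  ring_nf

/-- `Σ coef·c_y = 0` over `terms8`. -/
theorem terms8_sum_cy (A B : Fin 4 → ℕ) : ((terms8 A B).map fun T => T.coef * T.cy).sum = 0 := by
  simp only [terms8, List.map_cons, List.map_nil, List.sum_cons, List.sum_nil]; ring

/-- `Σ coef·c_x = 0` over `terms8`. -/
theorem terms8_sum_cx (A B : Fin 4 → ℕ) : ((terms8 A B).map fun T => T.coef * T.cx).sum = 0 := by
  simp only [terms8, List.map_cons, List.map_nil, List.sum_cons, List.sum_nil]; ring

/-- **Checked cell ⇒ digit count (second tale).**  If `Cell.check (terms8 A B) C = true` and the prime (any `p > 0`)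
satisfies `a₀/b₀ < n/p − m < a₁/b₁` (cross-multiplied), then `C.c ≤ digitT p â b̂ k` for EVERY `k`. -/
theorem digitT_ge_of_checked_cell {A B : Fin 4 → ℕ} {C : Cell} (hcheck : Cell.check (terms8 A B) C = true)
    {n p : ℕ} (hp : 0 < p) (m : ℕ)
    (hx0 : C.a0 * (p : ℤ) < (C.b0 : ℤ) * ((n : ℤ) - m * p)) (hx1 : (C.b1 : ℤ) * ((n : ℤ) - m * p) < C.a1 * (p : ℤ))
    (k : ℤ) : C.c ≤ digitT p (aTwo A n) (bTwo B n) k := by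
  obtain ⟨gx0, gx1⟩ := cell_mem_div (denoms_pos_of_check hcheck) hp m hx0 hx1
  rw [digitT_eq_evalTerms]
  set y : ℚ := ((((k - 1 : ℤ)) : ℚ) / p) with hy
  have e1 : evalTerms (terms8 A B) ((n : ℚ) / p) y = evalTerms (terms8 A B) ((n : ℚ) / p - m) (Int.fract y) := by
    conv_lhs => rw [← Int.fract_add_floor y, show (n : ℚ) / p = ((n : ℚ) / p - m) + ((m : ℤ) : ℚ) by push_cast; ring]
    rw [evalTerms_add_int_y, terms8_sum_cy, evalTerms_add_int_x, terms8_sum_cx]; simp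
  rw [e1]
  exact Cell.check_sound hcheck gx0 gx1 (Int.fract_nonneg _) (Int.fract_lt_one _)

section Padic

variable {p : ℕ} [Fact p.Prime]

/-- **Lemma 8 for `p̂` from a checked cell**: `‖p̂(â,b̂)‖_p ≤ p^{2−c}` for every prime of the cell with `2·b̂₃* ≤ p²`. -/
theorem padicNorm_formPT_le_of_cell {A B : Fin 4 → ℕ} {n : ℕ} (hab : AdmissibleT (aTwo A n) (bTwo B n))
    (hp2 : 2 * bMax (bTwo B n) ≤ (p : ℤ) ^ 2) {C : Cell} (hcheck : Cell.check (terms8 A B) C = true) (m : ℕ)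
    (hx0 : C.a0 * (p : ℤ) < (C.b0 : ℤ) * ((n : ℤ) - m * p)) (hx1 : (C.b1 : ℤ) * ((n : ℤ) - m * p) < C.a1 * (p : ℤ)) :
    padicNorm p (formPT (aTwo A n) (bTwo B n)) ≤ (p : ℚ) ^ (2 - C.c) :=
  padicNorm_formPT_le hab (by rw [bTwo_zero]; positivity) (by rw [bTwo_one]; positivity) hp2
    (fun k _ => digitT_ge_of_checked_cell hcheck (Fact.out : p.Prime).pos m hx0 hx1 k)

/-- **Lemma 8 for `q̂` from a checked cell**: `‖q̂(â,b̂)‖_p ≤ p^{−c}` for every prime of the cell with `2·b̂₃* ≤ p²`. -/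
theorem padicNorm_formQT_le_of_cell {A B : Fin 4 → ℕ} {n : ℕ} (hab : AdmissibleT (aTwo A n) (bTwo B n))
    (hp2 : 2 * bMax (bTwo B n) ≤ (p : ℤ) ^ 2) {C : Cell} (hcheck : Cell.check (terms8 A B) C = true) (m : ℕ)
    (hx0 : C.a0 * (p : ℤ) < (C.b0 : ℤ) * ((n : ℤ) - m * p)) (hx1 : (C.b1 : ℤ) * ((n : ℤ) - m * p) < C.a1 * (p : ℤ)) :
    padicNorm p (formQT (aTwo A n) (bTwo B n)) ≤ (p : ℚ) ^ (-C.c) :=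
  padicNorm_formQT_le hab (by rw [bTwo_zero]; positivity) (by rw [bTwo_one]; positivity) hp2
    (fun k _ => digitT_ge_of_checked_cell hcheck (Fact.out : p.Prime).pos m hx0 hx1 k)

end Padic

/-! ### First tale: the Legendre digits of Lemma 7 as a floor table -/

/-- The first tale's numerator parameters at level `n` from slopes: `a = (α_i n + 1)_i`. -/
def aOne (α : Fin 4 → ℕ) (n : ℕ) : Fin 4 → ℤ := fun i => (α i : ℤ) * n + 1

/-- The first tale's denominator parameters at level `n` from slopes: `b = (β₀n+1, β₁n+1, β₂n+1, β₃n+2)`. -/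
def bOne (β : Fin 4 → ℕ) (n : ℕ) : Fin 4 → ℤ := ![(β 0 : ℤ) * n + 1, (β 1 : ℤ) * n + 1, (β 2 : ℤ) * n + 1, (β 3 : ℤ) * n + 2]

/-- `a_i = α_i n + 1`. -/
@[simp] theorem aOne_apply (α : Fin 4 → ℕ) (n : ℕ) (i : Fin 4) : aOne α n i = (α i : ℤ) * n + 1 := rfl
/-- `b₀ = β₀n+1`. -/
@[simp] theorem bOne_zero (β : Fin 4 → ℕ) (n : ℕ) : bOne β n 0 = (β 0 : ℤ) * n + 1 := rfl
/-- `b₁ = β₁n+1`. -/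
@[simp] theorem bOne_one (β : Fin 4 → ℕ) (n : ℕ) : bOne β n 1 = (β 1 : ℤ) * n + 1 := rfl
/-- `b₂ = β₂n+1`. -/
@[simp] theorem bOne_two (β : Fin 4 → ℕ) (n : ℕ) : bOne β n 2 = (β 2 : ℤ) * n + 1 := rfl
/-- `b₃ = β₃n+2` (Zudilin's `b₄`). -/
@[simp] theorem bOne_three (β : Fin 4 → ℕ) (n : ℕ) : bOne β n 3 = (β 3 : ℤ) * n + 2 := rfl

/-- Permuting the slopes permutes the parameters: `aOne α n ∘ σ = aOne (α ∘ σ) n`. -/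
theorem aOne_comp (α : Fin 4 → ℕ) (n : ℕ) (σ : Equiv.Perm (Fin 4)) : aOne α n ∘ σ = aOne (α ∘ σ) n := rfl

/-- **The four Legendre terms of `ord_p Π(a,b)`** (`y`-free): `⌊(β₃−α₃)x⌋ − ⌊(α₀−β₀)x⌋ − ⌊(α₁−β₁)x⌋ − ⌊(α₂−β₂)x⌋`. -/
def piTerms (α β : Fin 4 → ℕ) : List Term :=
  [⟨1, 0, (β 3 : ℤ) - α 3⟩, ⟨-1, 0, (α 0 : ℤ) - β 0⟩, ⟨-1, 0, (α 1 : ℤ) - β 1⟩, ⟨-1, 0, (α 2 : ℤ) - β 2⟩]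

/-- **The term list of `ord_p Π(a,b) − ord_p Π(σa,b)`.** -/
def terms7 (α β : Fin 4 → ℕ) (σ : Equiv.Perm (Fin 4)) : List Term := piTerms α β ++ negTerms (piTerms (α ∘ σ) β)

/-- `Σ coef·c_x` over `piTerms` is `Σβ + 1·… ` — precisely `(β₀+β₁+β₂+β₃) − (α₀+α₁+α₂+α₃)`. -/
theorem piTerms_sum_cx (α β : Fin 4 → ℕ) : ((piTerms α β).map fun T => T.coef * T.cx).sum
    = ((β 0 : ℤ) + β 1 + β 2 + β 3) - ((α 0 : ℤ) + α 1 + α 2 + α 3) := by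
  simp only [piTerms, List.map_cons, List.map_nil, List.sum_cons, List.sum_nil]; ring

/-- `Σ coef·c_x = 0` over `terms7` (a permutation does not change `Σ α`). -/
theorem terms7_sum_cx (α β : Fin 4 → ℕ) (σ : Equiv.Perm (Fin 4)) :
    ((terms7 α β σ).map fun T => T.coef * T.cx).sum = 0 := by
  rw [terms7, List.map_append, List.sum_append, negTerms_sum_cx, piTerms_sum_cx, piTerms_sum_cx]
  have hs : ∑ i, ((α ∘ σ) i : ℤ) = ∑ i, (α i : ℤ) := Equiv.sum_comp σ (fun i => (α i : ℤ))
  simp only [Fin.sum_univ_four, Function.comp] at hs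
  simp only [Function.comp]
  linarith

/-- `Σ coef·c_y = 0` over `terms7` (every term is `y`-free). -/
theorem terms7_sum_cy (α β : Fin 4 → ℕ) (σ : Equiv.Perm (Fin 4)) :
    ((terms7 α β σ).map fun T => T.coef * T.cy).sum = 0 := by
  rw [terms7, List.map_append, List.sum_append, negTerms_sum_cy]
  simp [piTerms]

section Padic

variable {p : ℕ} [Fact p.Prime]

/-- **(L7, one tale) `ord_p Π(a,b) = Σ_{T ∈ piTerms α β} T(n/p, 0)`** for slopes with `β_j ≤ α_j` (`j ≤ 2`),
`α₃ ≤ β₃` and a prime with `β₃ n < p²` (one Legendre digit per factorial). -/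
theorem padicValRat_Pi_eq_evalTerms {α β : Fin 4 → ℕ} {n : ℕ} (h0 : β 0 ≤ α 0) (h1 : β 1 ≤ α 1) (h2 : β 2 ≤ α 2)
    (h3 : α 3 ≤ β 3) (hα : ∀ i, α i ≤ β 3) (hsq : β 3 * n < p ^ 2) :
    padicValRat p (Pi (aOne α n) (bOne β n)) = evalTerms (piTerms α β) ((n : ℚ) / p) 0 := by
  -- the four differences are the natural numbers `(β₃−α₃)n`, `(α_j−β_j)n`
  have d3 : bOne β n 3 - aOne α n 3 - 1 = (((β 3 - α 3) * n : ℕ) : ℤ) := by simp; push_cast [Nat.cast_sub h3]; ring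
  have d0 : aOne α n 0 - bOne β n 0 = (((α 0 - β 0) * n : ℕ) : ℤ) := by simp; push_cast [Nat.cast_sub h0]; ring
  have d1 : aOne α n 1 - bOne β n 1 = (((α 1 - β 1) * n : ℕ) : ℤ) := by simp; push_cast [Nat.cast_sub h1]; ring
  have d2 : aOne α n 2 - bOne β n 2 = (((α 2 - β 2) * n : ℕ) : ℤ) := by simp; push_cast [Nat.cast_sub h2]; ring
  have l3 : (β 3 - α 3) * n < p ^ 2 := lt_of_le_of_lt (Nat.mul_le_mul_right _ (Nat.sub_le _ _)) hsq
  have l0 : (α 0 - β 0) * n < p ^ 2 :=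
    lt_of_le_of_lt (Nat.mul_le_mul_right _ ((Nat.sub_le _ _).trans (hα 0))) hsq
  have l1 : (α 1 - β 1) * n < p ^ 2 :=
    lt_of_le_of_lt (Nat.mul_le_mul_right _ ((Nat.sub_le _ _).trans (hα 1))) hsq
  have l2 : (α 2 - β 2) * n < p ^ 2 :=
    lt_of_le_of_lt (Nat.mul_le_mul_right _ ((Nat.sub_le _ _).trans (hα 2))) hsq
  rw [padicValRat_Pi_eq (by rw [d3, Int.toNat_natCast]; exact l3) (by rw [d0, Int.toNat_natCast]; exact l0)
    (by rw [d1, Int.toNat_natCast]; exact l1) (by rw [d2, Int.toNat_natCast]; exact l2), d3, d0, d1, d2]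
  simp only [Int.toNat_natCast, Int.natCast_div, evalTerms, piTerms, List.map_cons, List.map_nil, List.sum_cons,
    List.sum_nil, Term.eval, floor_lin_zero]
  push_cast [Nat.cast_sub h0, Nat.cast_sub h1, Nat.cast_sub h2, Nat.cast_sub h3]
  ring_nf

/-- **(L7) `ord_p Π(a,b) − ord_p Π(σa,b) = Σ_{T ∈ terms7 α β σ} T(n/p, 0)`** under slope admissibility
`β_j ≤ α_i` (`j ≤ 2`, all `i`), `α_i ≤ β₃` (all `i`) and `β₃ n < p²`. -/
theorem padicValRat_Pi_sub_eq_evalTerms {α β : Fin 4 → ℕ} {n : ℕ} (hβα : ∀ j i : Fin 4, j ≠ 3 → β j ≤ α i)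
    (hαβ : ∀ i, α i ≤ β 3) (hsq : β 3 * n < p ^ 2) (σ : Equiv.Perm (Fin 4)) :
    padicValRat p (Pi (aOne α n) (bOne β n)) - padicValRat p (Pi (aOne α n ∘ σ) (bOne β n))
      = evalTerms (terms7 α β σ) ((n : ℚ) / p) 0 := by
  rw [aOne_comp, padicValRat_Pi_eq_evalTerms (hβα 0 0 (by decide)) (hβα 1 1 (by decide)) (hβα 2 2 (by decide))
      (hαβ 3) hαβ hsq,
    padicValRat_Pi_eq_evalTerms (α := α ∘ σ) (hβα 0 _ (by decide)) (hβα 1 _ (by decide)) (hβα 2 _ (by decide))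
      (hαβ _) (fun i => hαβ _) hsq, terms7, evalTerms_append, evalTerms_negTerms]
  ring

/-- **Checked cell ⇒ Legendre digits (first tale).**  If `Cell.check (terms7 α β σ) C = true` and the prime satisfies
`a₀/b₀ < n/p − m < a₁/b₁` (cross-multiplied), then `C.c ≤ ord_p Π(a,b) − ord_p Π(σa,b)`. -/
theorem piDiff_ge_of_checked_cell {α β : Fin 4 → ℕ} {σ : Equiv.Perm (Fin 4)} {C : Cell}
    (hcheck : Cell.check (terms7 α β σ) C = true) (hβα : ∀ j i : Fin 4, j ≠ 3 → β j ≤ α i) (hαβ : ∀ i, α i ≤ β 3)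
    {n : ℕ} (hsq : β 3 * n < p ^ 2) (m : ℕ)
    (hx0 : C.a0 * (p : ℤ) < (C.b0 : ℤ) * ((n : ℤ) - m * p)) (hx1 : (C.b1 : ℤ) * ((n : ℤ) - m * p) < C.a1 * (p : ℤ)) :
    C.c ≤ padicValRat p (Pi (aOne α n) (bOne β n)) - padicValRat p (Pi (aOne α n ∘ σ) (bOne β n)) := by
  obtain ⟨gx0, gx1⟩ := cell_mem_div (denoms_pos_of_check hcheck) (Fact.out : p.Prime).pos m hx0 hx1
  rw [padicValRat_Pi_sub_eq_evalTerms hβα hαβ hsq σ]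
  have e1 : evalTerms (terms7 α β σ) ((n : ℚ) / p) 0 = evalTerms (terms7 α β σ) ((n : ℚ) / p - m) 0 := by
    conv_lhs => rw [show (n : ℚ) / p = ((n : ℚ) / p - m) + ((m : ℤ) : ℚ) by push_cast; ring]
    rw [evalTerms_add_int_x, terms7_sum_cx]; simp
  rw [e1]
  exact Cell.check_sound hcheck gx0 gx1 le_rfl one_pos

/-- **Lemma 7 for `q` from a checked cell**: `p^c ∣ q(a,b)` (the integer `formQZ`), `c = C.c.toNat`. -/
theorem pow_dvd_formQZ_of_cell {α β : Fin 4 → ℕ} {σ : Equiv.Perm (Fin 4)} {C : Cell} {n : ℕ}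
    (hadm : Admissible (aOne α n) (bOne β n)) (hcheck : Cell.check (terms7 α β σ) C = true)
    (hβα : ∀ j i : Fin 4, j ≠ 3 → β j ≤ α i) (hαβ : ∀ i, α i ≤ β 3) (hsq : β 3 * n < p ^ 2) (m : ℕ)
    (hx0 : C.a0 * (p : ℤ) < (C.b0 : ℤ) * ((n : ℤ) - m * p)) (hx1 : (C.b1 : ℤ) * ((n : ℤ) - m * p) < C.a1 * (p : ℤ)) :
    (p : ℤ) ^ C.c.toNat ∣ formQZ (aOne α n) (bOne β n) := by
  rcases le_or_gt 0 C.c with hc | hc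
  · exact pow_dvd_formQZ hadm σ (by
      rw [Int.toNat_of_nonneg hc]; exact piDiff_ge_of_checked_cell hcheck hβα hαβ hsq m hx0 hx1)
  · rw [Int.toNat_of_nonpos hc.le, pow_zero]; exact one_dvd _

/-- **Lemma 7 for `p` from a checked cell**: `p^c ∣ D_{M₁} D_{M₂} p(a,b)` (the integer `formPZ a b M₁ M₂`),
`c = C.c.toNat`, for any `(M₁, M₂)` clearing the denominators of `p(a,b)` and `p(σa,b)` (hypotheses of
`Zudilin2014.pow_dvd_formPZ`, passed through). -/
theorem pow_dvd_formPZ_of_cell {α β : Fin 4 → ℕ} {σ : Equiv.Perm (Fin 4)} {C : Cell} {n : ℕ}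
    (hadm : Admissible (aOne α n) (bOne β n)) {M₁ M₂ : ℕ}
    (hc : ∀ j : Fin 4, j ≠ 3 → (aOne α n j - bOne β n j).toNat ≤ M₁)
    (hcσ : ∀ j : Fin 4, j ≠ 3 → ((aOne α n ∘ σ) j - bOne β n j).toNat ≤ M₁)
    (hK₁ : (bOne β n 3 - a2star (aOne α n) - 1).toNat ≤ M₁) (hK₂ : (bOne β n 3 - a2star (aOne α n) - 1).toNat ≤ M₂)
    (hd : dExp (aOne α n) (bOne β n) + 1 ≤ M₂)
    (hcheck : Cell.check (terms7 α β σ) C = true)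
    (hβα : ∀ j i : Fin 4, j ≠ 3 → β j ≤ α i) (hαβ : ∀ i, α i ≤ β 3) (hsq : β 3 * n < p ^ 2) (m : ℕ)
    (hx0 : C.a0 * (p : ℤ) < (C.b0 : ℤ) * ((n : ℤ) - m * p)) (hx1 : (C.b1 : ℤ) * ((n : ℤ) - m * p) < C.a1 * (p : ℤ)) :
    (p : ℤ) ^ C.c.toNat ∣ formPZ (aOne α n) (bOne β n) M₁ M₂ := by
  rcases le_or_gt 0 C.c with hc0 | hc0
  · exact pow_dvd_formPZ hadm σ hc hcσ hK₁ hK₂ hd (by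
      rw [Int.toNat_of_nonneg hc0]; exact piDiff_ge_of_checked_cell hcheck hβα hαβ hsq m hx0 hx1)
  · rw [Int.toNat_of_nonpos hc0.le, pow_zero]; exact one_dvd _

end Padic

end Denom.DigitBridge

end Summit.KontsevichZagierPeriods.Zeta5Search
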